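import Mathlib

/-!
# Conjecture N (hodge-weil ladder, GAPS G51b), format (5,3): CROSS + TWO FREE E-ROOTS — eventual positivity of a quintic (exit `t → −∞`)

Prover 2, generation 24 (note `run/shared/lean/b2b/hodge-weil/b2b-hweil-pv2-g24/CROSSPLUS3-G24.md` §2.4). In the t-endpoint reduction of the k = 2 piece the
Cauchy–Schwarz numerator `H` is a quintic in `t` with leading coefficient `−m X²(u₁+u₂)² ≤ 0` (and, when `u₁+u₂ = 0`, a quartic with leading coefficient
`2m³Xu₁² ≥ 0`), so `H > 0` for all sufficiently negative `t`: the feasible t-set `{H ≤ 0}` is bounded below. This file proves the two elementary real-analysis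
facts used there, with explicit thresholds: **`quintic_pos_eventually`** (`c₅ < 0`) and **`quartic_pos_eventually`** (`c₅ = 0`, `c₄ > 0`).
Pure Mathlib; nothing here is a case of HC, a rung or a door edge; no statement of Markman's papers is used. New cell result ⇒ Summits/.
-/

set_option linter.dupNamespace false

namespace Summit.HodgeConjecture.HodgeConjecture.WeilClassTestFormatFiveThreeCrossPlusTwoAsymptotics

/-- For `τ ≤ −1`: the powers satisfy `1 ≤ −τ ≤ τ² ≤ −τ³ ≤ τ⁴ ≤ −τ⁵`… packaged as the bounds used below. -/
theorem pow_chain (τ : ℝ) (hτ : τ ≤ -1) :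
    1 ≤ -τ ∧ -τ ≤ τ ^ 2 ∧ τ ^ 2 ≤ -τ ^ 3 ∧ -τ ^ 3 ≤ τ ^ 4 := by
  have h1 : 1 ≤ -τ := by linarith
  have h2 : -τ ≤ τ ^ 2 := by nlinarith
  have h3 : τ ^ 2 ≤ -τ ^ 3 := by nlinarith
  have h4 : -τ ^ 3 ≤ τ ^ 4 := by nlinarith
  exact ⟨h1, h2, h3, h4⟩

/-- **Eventual positivity of a quintic with negative leading coefficient**: if `c₅ < 0` then for every
`τ ≤ min (−1) ((|c₄| + |c₃| + |c₂| + |c₁| + |c₀| + 1)/c₅)` one has `c₅τ⁵ + c₄τ⁴ + c₃τ³ + c₂τ² + c₁τ + c₀ > 0`. -/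
theorem quintic_pos_eventually (c0 c1 c2 c3 c4 c5 τ : ℝ) (hc5 : c5 < 0)
    (hτ1 : τ ≤ -1) (hτ2 : τ ≤ (|c4| + |c3| + |c2| + |c1| + |c0| + 1) / c5) :
    0 < c5 * τ ^ 5 + c4 * τ ^ 4 + c3 * τ ^ 3 + c2 * τ ^ 2 + c1 * τ + c0 := by
  obtain ⟨h1, h2, h3, h4⟩ := pow_chain τ hτ1
  have hτ4 : 1 ≤ τ ^ 4 := by linarith
  -- c5 * τ ≥ |c4| + |c3| + |c2| + |c1| + |c0| + 1
  have hlead : |c4| + |c3| + |c2| + |c1| + |c0| + 1 ≤ c5 * τ := by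
    have := mul_le_mul_of_nonpos_left hτ2 hc5.le
    have hc5ne : c5 ≠ 0 := ne_of_lt hc5
    calc |c4| + |c3| + |c2| + |c1| + |c0| + 1 = c5 * ((|c4| + |c3| + |c2| + |c1| + |c0| + 1) / c5) := by field_simp
      _ ≤ c5 * τ := this
  -- bounds on the lower-order terms
  have b4 : -(|c4| * τ ^ 4) ≤ c4 * τ ^ 4 := by nlinarith [neg_abs_le c4, hτ4]
  have b3 : -(|c3| * τ ^ 4) ≤ c3 * τ ^ 3 := by
    nlinarith [abs_nonneg c3, neg_abs_le c3, le_abs_self c3, h4, h3, h2, h1]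
  have b2 : -(|c2| * τ ^ 4) ≤ c2 * τ ^ 2 := by
    nlinarith [abs_nonneg c2, neg_abs_le c2, le_abs_self c2, h4, h3, h2, h1]
  have b1 : -(|c1| * τ ^ 4) ≤ c1 * τ := by
    nlinarith [abs_nonneg c1, neg_abs_le c1, le_abs_self c1, h4, h3, h2, h1]
  have b0 : -(|c0| * τ ^ 4) ≤ c0 := by
    nlinarith [abs_nonneg c0, neg_abs_le c0, le_abs_self c0, h4, h3, h2, h1]
  have hmain : (|c4| + |c3| + |c2| + |c1| + |c0| + 1) * τ ^ 4 ≤ c5 * τ ^ 5 := by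
    have : c5 * τ ^ 5 = (c5 * τ) * τ ^ 4 := by ring
    rw [this]
    exact mul_le_mul_of_nonneg_right hlead (by positivity)
  nlinarith [hmain, b4, b3, b2, b1, b0, hτ4]

/-- **Eventual positivity of a quartic with positive leading coefficient** (the case `c₅ = 0`): if `c₄ > 0` then for every
`τ ≤ min (−1) (−(|c₃| + |c₂| + |c₁| + |c₀| + 1)/c₄)` one has `c₄τ⁴ + c₃τ³ + c₂τ² + c₁τ + c₀ > 0`. -/
theorem quartic_pos_eventually (c0 c1 c2 c3 c4 τ : ℝ) (hc4 : 0 < c4)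
    (hτ1 : τ ≤ -1) (hτ2 : τ ≤ -(|c3| + |c2| + |c1| + |c0| + 1) / c4) :
    0 < c4 * τ ^ 4 + c3 * τ ^ 3 + c2 * τ ^ 2 + c1 * τ + c0 := by
  obtain ⟨h1, h2, h3, h4⟩ := pow_chain τ hτ1
  have hτ3 : 1 ≤ -τ ^ 3 := by linarith
  -- c4 * (-τ) ≥ |c3| + |c2| + |c1| + |c0| + 1
  have hlead : |c3| + |c2| + |c1| + |c0| + 1 ≤ c4 * (-τ) := by
    have hc4ne : c4 ≠ 0 := ne_of_gt hc4
    have : -τ ≥ (|c3| + |c2| + |c1| + |c0| + 1) / c4 := by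
      have := hτ2; rw [neg_div] at this; linarith
    calc |c3| + |c2| + |c1| + |c0| + 1 = c4 * ((|c3| + |c2| + |c1| + |c0| + 1) / c4) := by field_simp
      _ ≤ c4 * (-τ) := mul_le_mul_of_nonneg_left this hc4.le
  have b3 : -(|c3| * (-τ ^ 3)) ≤ c3 * τ ^ 3 := by nlinarith [abs_nonneg c3, neg_abs_le c3, le_abs_self c3, hτ3]
  have b2 : -(|c2| * (-τ ^ 3)) ≤ c2 * τ ^ 2 := by nlinarith [abs_nonneg c2, neg_abs_le c2, le_abs_self c2, h3, h2, h1]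
  have b1 : -(|c1| * (-τ ^ 3)) ≤ c1 * τ := by nlinarith [abs_nonneg c1, neg_abs_le c1, le_abs_self c1, h3, h2, h1]
  have b0 : -(|c0| * (-τ ^ 3)) ≤ c0 := by nlinarith [abs_nonneg c0, neg_abs_le c0, le_abs_self c0, h3, h2, h1]
  have hmain : (|c3| + |c2| + |c1| + |c0| + 1) * (-τ ^ 3) ≤ c4 * τ ^ 4 := by
    have : c4 * τ ^ 4 = (c4 * (-τ)) * (-τ ^ 3) := by ring
    rw [this]
    exact mul_le_mul_of_nonneg_right hlead (by linarith)
  nlinarith [hmain, b3, b2, b1, b0, hτ3]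

end Summit.HodgeConjecture.HodgeConjecture.WeilClassTestFormatFiveThreeCrossPlusTwoAsymptotics
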